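import Literature.Analysis.FluidPDE.DeRosaGluedStageAssembly
import Literature.Analysis.FluidPDE.FracNSStability
import HarnessLib

/-!
# De Rosa's gluing stage, §5.2: Cor. 5.2 and Prop. 5.3 in the currency of the scheme

L. De Rosa, *Infinitely many Leray–Hopf solutions for the fractional Navier–Stokes equations*,
Comm. PDE 44 (2019) 335–365 = arXiv:1801.10235, §5.2: for the exact solutions `vᵢ` of (5.9)
(`vᵢ(·,tᵢ) = v_ℓ(·,tᵢ)`), "An immediate consequence of (5.6), (5.7) and Proposition 3.5 is"
Cor. 5.2: "If `a` is sufficiently large, for `0 ≤ t - tᵢ ≤ 2τ_q`, we have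
`‖vᵢ‖_{N+α} ≲ δ_q^{1/2}λ_qℓ^{1-N-α} ≲ τ_q⁻¹ℓ^{1-N+α}` for any `N ≥ 1`" (the CFL-like condition (5.8)
`2τ_q‖v_ℓ‖_{1+α} ≲ τ_qδ_q^{1/2}λ_qℓ^{-α} ≲ ℓ^α ≪ 1`), and Prop. 5.3: "For `0 ≤ t - tᵢ ≤ 2τ_q`, `N ≥ 0`
and `0 < ν < 1` we have (5.10) `‖vᵢ - v_ℓ‖_{N+α} ≲ τ_qδ_{q+1}ℓ^{-N-1+α}`,
(5.11) `‖∇(p_ℓ - pᵢ)‖_{N+α} ≲ δ_{q+1}ℓ^{-N-1+α}`, (5.12′) `‖L_{t,ℓ,γ}(vᵢ - v_ℓ)‖_{N+α} ≲ δ_{q+1}ℓ^{-N-1+α}`,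
(5.12) `‖D_{t,ℓ}(vᵢ - v_ℓ)‖_{N+α} ≲ δ_{q+1}ℓ^{-N-1+α}`", the last step being "By Theorem 7.1 and (5.10),
`ν‖(-Δ)^γ(v_ℓ - vᵢ)‖_{N+α} ≲ ‖v_ℓ - vᵢ‖_{N+2γ+2α} ≲ τ_qδ_{q+1}ℓ^{-N-1-2γ-α}`. If `a` is chosen
sufficiently large … `τ_qℓ^{-2γ-2α} ≤ λ_{q+1}^{2γ}/(δ_q^{1/2}λ_q) ≤ 1`, from which (5.34)
`ν‖(-Δ)^γ(v_ℓ - vᵢ)‖_{N+α} ≲ δ_{q+1}ℓ^{-N-1+α}`" (pp. 11–12).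

The dimensionless analysis is in the tree: Prop. 3.5 = `DeRosa.fracNSApriori` (`FracNSApriori.lean`),
Prop. 5.3 (5.10)–(5.12′) = `DeRosa.fracStability` (`FracNSStability.lean`), Thm. 7.1 =
`Torus.exists_eContDiffHolderNorm_fracLaplacian_le` (`FracLaplacianHolder.lean`). This file converts
them into the currency of the scheme, i.e. into the predicate `BDSV.StabilityBounds` consumed by the
glued-triple estimates (`DeRosaGluedStageAssembly.lean`):

* `DeRosa.exists_threshold_glueScale_rpow` — the threshold of (5.34): `K τ_q ℓ^{-s} ≤ 1` for all `q`
  once `a` is large, given `s ≤ 2γ + 2α`-type negativity of the exponent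
  (`(β-1)(1-2γ) + 3αγ + 2bγβ < 0`, implied by `b < (1-β)/(2β)`, `γ < 1/3`, `α` small);
* `DeRosa.exists_threshold_cfl` — the CFL condition (5.8): `K ℓ^α ≤ c` once `a` is large;
* `DeRosa.stabilityBounds_of_exact` — **Cor. 5.2 and Prop. 5.3 for the scheme**: for
  `0 < γ < β < 1/3`, `1 < b < (1-β)/(2β)` there is `α₀ > 0` such that for `0 < α < α₀`, every `N̄` and
  input constants `(C_N)` there are `C`, `a₀` such that for `a ≥ a₀`, `ν ∈ [0,1]`, `T > 0`, `q`, every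
  smooth solution `(v_ℓ, p_ℓ, R̊_ℓ)` of the fractional NSR system on `[0,T]` with (5.6)–(5.7′), every
  `j` with `jτ_q ≤ T` and every smooth exact solution `(u, p)` of (5.9) on the life span
  `S_j = [jτ_q - τ_q, jτ_q + τ_q] ∩ [0,T]` with `u = v_ℓ` at its left endpoint:
  `BDSV.StabilityBounds β α a b T C q N̄ j v_ℓ p_ℓ u p` (Cor. 5.2 for `1 ≤ N ≤ N̄`, (5.10), (5.11), (5.12)
  for `N ≤ N̄`).

With `DeRosa.gluedTriple_of_commutatorCZBound` this reduces `DeRosa.gluingStage` to the existence of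
the exact solutions on the life spans (Thm. 3.4 with the continuation given by Prop. 3.5), the
vector-potential bounds of Prop. 5.4 (`BDSV.PotentialBounds`) and `BDSV.commutatorCZBound`.

## References

* L. De Rosa, Comm. PDE 44 (2019) = arXiv:1801.10235, §5.2 (5.7)–(5.12), Cor. 5.2, Prop. 5.3 and
  its proof ((5.34)), §3.2 Prop. 3.5, §7 Thm. 7.1. [`Derosa2018`]
* T. Buckmaster, C. De Lellis, L. Székelyhidi Jr., V. Vicol, CPAM 72 (2019) = arXiv:1701.08678,
  §2.5 (CFL), Cor. 3.2, Prop. 3.3, App. A (A.3). [`BuckmasterEtAl2018`]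
-/

noncomputable section

open MeasureTheory Set Filter Topology Function
open scoped NNReal ENNReal ContDiff

namespace Literature.Analysis.FluidPDE

namespace DeRosa

open FunctionSpaces FunctionSpaces.Torus
open BDSV hiding IsGlueFamily

/-! ## Two thresholds -/

section Params

variable {β α a b : ℝ}

/-- **`τ_q ℓ^{-s}` as a monomial**: `τ_q ℓ^{-s} = λ_q^{(β-1-3α/2)(2α-s) + β - 1} λ_{q+1}^{-β(2α-s)}`
(`a ≥ 1`). [folklore] -/
theorem glueScale_mul_mollScale_rpow_eq (ha : 1 ≤ a) (q : ℕ) (s : ℝ) :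
    glueScale β α a b q * mollScale β α a b q ^ (-s) =
      freq a b q ^ ((β - 1 - 3 * α / 2) * (2 * α - s) + (β - 1)) * freq a b (q + 1) ^ (-β * (2 * α - s)) := by
  have hf := freq_pos (b := b) ha q
  have hℓ := mollScale_pos (β := β) (α := α) (b := b) ha q
  rw [glueScale_eq_monomial ha q, mul_right_comm, ← Real.rpow_add hℓ, show (2 * α + -s : ℝ) = 2 * α - s by ring,
    mollScale_rpow_eq_monomial ha q (2 * α - s), Real.rpow_add hf]
  ring

/-- **The threshold of (5.34)** ("If `a` is chosen sufficiently large … `τ_qℓ^{-2γ-2α} ≤ λ_{q+1}^{2γ}/(δ_q^{1/2}λ_q) ≤ 1`"):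
for `0 < β < 1`, `1 ≤ b`, `s ≥ 0` with `(1-β)(2α - s - 1 - 3α(2α-s)/(1-β)…)`-type negativity
written as `(β - 1)(1 + 2α - s) - (3α/2)(2α - s) + bβ(s - 2α) < 0`, and any `K`, there is `a₁ > 1`
with `K τ_q ℓ^{-s} ≤ 1` for all `a ≥ a₁` and `q`. For `s = 2γ + 2α` the condition reads
`2bγβ + 3αγ < (1-β)(1-2γ)`, which holds when `b < (1-β)/(2β)`, `γ < 1/3` and
`3αγ ≤ (1-β)(1-3γ)`. [cite: Derosa2018, §5.2 Prop. 5.3 (proof of (5.12), (5.34))] -/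
theorem exists_threshold_glueScale_rpow (hb : 1 ≤ b) {s : ℝ}
    (hE : (β - 1 - 3 * α / 2) * (2 * α - s) + (β - 1) + b * (-β * (2 * α - s)) < 0) (K : ℝ) :
    ∃ a₁ : ℝ, 1 < a₁ ∧ ∀ a : ℝ, a₁ ≤ a → ∀ q : ℕ,
      K * (glueScale β α a b q * mollScale β α a b q ^ (-s)) ≤ 1 := by
  have hE' : (β - 1 - 3 * α / 2) * (2 * α - s) + (β - 1) + b * (-β * (2 * α - s)) + b ^ 2 * 0 < 0 := by linarith
  obtain ⟨a₁, ha₁, hmain⟩ := exists_freq_triple_le hb hE' K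
  refine ⟨a₁, ha₁, fun a ha q => ?_⟩
  have ha1 : 1 ≤ a := le_trans ha₁.le ha
  have key := hmain a ha q
  rw [Real.rpow_zero, mul_one] at key
  rwa [glueScale_mul_mollScale_rpow_eq ha1 q s]

/-- **The CFL threshold (5.8)** ("`2τ_q‖v_ℓ‖_{1+α} ≲ ℓ^α ≪ 1` as long as `a` is sufficiently large"):
for `b ≥ 1`, `β ≥ 0`, `α > 0`, `c > 0` and any `K` there is `a₁ > 1` with `K ℓ^α ≤ c` for all
`a ≥ a₁` and `q` (`ℓ^α ≤ λ_q^{-α}`). [cite: Derosa2018, §5.2 (5.8)] -/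
theorem exists_threshold_cfl (hb : 1 ≤ b) (hβ : 0 ≤ β) (hα : 0 < α) {c : ℝ} (hc : 0 < c) (K : ℝ) :
    ∃ a₁ : ℝ, 1 < a₁ ∧ ∀ a : ℝ, a₁ ≤ a → ∀ q : ℕ, K * mollScale β α a b q ^ α ≤ c := by
  obtain ⟨a₁, ha₁, h⟩ := exists_freq_triple_le hb (x := -α) (y := 0) (z := 0) (by nlinarith) (max K 0 / c)
  refine ⟨a₁, ha₁, fun a ha q => ?_⟩
  have ha1 : 1 ≤ a := le_trans ha₁.le ha
  have key := h a ha q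
  rw [Real.rpow_zero, Real.rpow_zero, mul_one, mul_one] at key
  have hℓ := mollScale_pos (β := β) (α := α) (b := b) ha1 q
  have h1 : mollScale β α a b q ^ α ≤ freq a b q ^ (-α) := mollScale_rpow_le ha1 hb hβ hα.le q
  have h2 : max K 0 * freq a b q ^ (-α) ≤ c := by
    have := mul_le_mul_of_nonneg_left key hc.le
    rw [mul_one, ← mul_assoc, mul_div_cancel₀ _ hc.ne'] at this
    exact this
  calc K * mollScale β α a b q ^ α ≤ max K 0 * mollScale β α a b q ^ α :=
        mul_le_mul_of_nonneg_right (le_max_left _ _) (Real.rpow_nonneg hℓ.le _)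
    _ ≤ max K 0 * freq a b q ^ (-α) := mul_le_mul_of_nonneg_left h1 (le_max_right _ _)
    _ ≤ c := h2

/-- `ℓ^{-m + x} = ℓ^x (ℓ⁻¹)^m`. [folklore] -/
theorem rpow_neg_natCast_add {ℓ : ℝ} (hℓ : 0 < ℓ) (x : ℝ) (m : ℕ) : ℓ ^ (-(m : ℝ) + x) = ℓ ^ x * ℓ⁻¹ ^ m := by
  have hexp : (-(m : ℝ) + x) = x + -(m : ℝ) := by ring
  rw [hexp, Real.rpow_add hℓ x (-(m : ℝ)), Real.rpow_neg hℓ.le, Real.rpow_natCast, inv_pow]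

/-- `ℓ^{-m - x} = ℓ^{-x} (ℓ⁻¹)^m`. [folklore] -/
theorem rpow_neg_natCast_sub {ℓ : ℝ} (hℓ : 0 < ℓ) (x : ℝ) (m : ℕ) : ℓ ^ (-(m : ℝ) - x) = ℓ ^ (-x) * ℓ⁻¹ ^ m := by
  have hexp : (-(m : ℝ) - x) = -x + -(m : ℝ) := by ring
  rw [hexp, Real.rpow_add hℓ (-x) (-(m : ℝ)), Real.rpow_neg hℓ.le (m : ℝ), Real.rpow_natCast, inv_pow]

/-- `ℓ^{-N-1+x} = ℓ^x (ℓ⁻¹)^{N+1}`. [folklore] -/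
theorem rpow_neg_natCast_sub_one_add {ℓ : ℝ} (hℓ : 0 < ℓ) (x : ℝ) (N : ℕ) :
    ℓ ^ (-(N : ℝ) - 1 + x) = ℓ ^ x * ℓ⁻¹ ^ (N + 1) := by
  have hexp : (-(N : ℝ) - 1 + x) = -((N + 1 : ℕ) : ℝ) + x := by push_cast; ring
  rw [hexp, rpow_neg_natCast_add hℓ x (N + 1)]

/-- `ℓ^{-2x} ℓ^{1-(M+1)+x} = ℓ^{-x} (ℓ⁻¹)^M`. [folklore] -/
theorem rpow_velocity_conversion {ℓ : ℝ} (hℓ : 0 < ℓ) (x : ℝ) (M : ℕ) :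
    ℓ ^ (-(2 * x)) * ℓ ^ (1 - ((M + 1 : ℕ) : ℝ) + x) = ℓ ^ (-x) * ℓ⁻¹ ^ M := by
  have hexp : (-(2 * x)) + (1 - ((M + 1 : ℕ) : ℝ) + x) = -(M : ℝ) + -x := by push_cast; ring
  rw [← Real.rpow_add hℓ, hexp, rpow_neg_natCast_add hℓ (-x) M]

/-- `(ℓ⁻¹)^{N+2} ℓ^{1-s} = (ℓ⁻¹)^{N+1} ℓ^{-s}`. [folklore] -/
theorem inv_pow_succ_mul_rpow {ℓ : ℝ} (hℓ : 0 < ℓ) (s : ℝ) (N : ℕ) :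
    ℓ⁻¹ ^ (N + 1 + 1) * ℓ ^ (1 - s) = ℓ⁻¹ ^ (N + 1) * ℓ ^ (-s) := by
  have hexp : (1 - s) = 1 + -s := by ring
  have hinv : ℓ⁻¹ * ℓ = 1 := inv_mul_cancel₀ hℓ.ne'
  rw [hexp, Real.rpow_add hℓ 1 (-s), Real.rpow_one, pow_succ]
  calc ℓ⁻¹ ^ (N + 1) * ℓ⁻¹ * (ℓ * ℓ ^ (-s)) = ℓ⁻¹ ^ (N + 1) * (ℓ⁻¹ * ℓ) * ℓ ^ (-s) := by ring
    _ = ℓ⁻¹ ^ (N + 1) * ℓ ^ (-s) := by rw [hinv, mul_one]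

end Params

/-! ## Cor. 5.2 and Prop. 5.3 in the currency of the scheme -/

section Stability

set_option maxHeartbeats 800000 in
/-- **De Rosa Cor. 5.2 and Prop. 5.3 for the scheme** (the bounds `BDSV.StabilityBounds` of the exact
solutions glued in §5.2, from the dimensionless Prop. 3.5 = `DeRosa.fracNSApriori`, Prop. 5.3 =
`DeRosa.fracStability`, Thm. 7.1 = `Torus.exists_eContDiffHolderNorm_fracLaplacian_le` and the
thresholds (5.8), (5.34)): for `0 < γ < β < 1/3` and `1 < b < (1-β)/(2β)` there is `α₀ > 0` such
that for `0 < α < α₀`, every `N̄` and every family of input constants `(C_N)` there are `C` and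
`a₀ > 1` such that for all `a ≥ a₀`, `ν ∈ [0,1]`, `T > 0`, `q`, every smooth solution
`(v_ℓ, p_ℓ, R̊_ℓ)` of the fractional NSR system on `[0,T] × 𝕋³` with (5.6)
`‖v_ℓ‖_{N+1} ≤ C_N δ_q^{1/2}λ_qℓ^{-N}` and (5.7′) `‖R̊_ℓ‖_{N+α} ≤ C_N δ_{q+1}ℓ^{-N+α}` (all `N`), every `j`
with `jτ_q ≤ T` and every smooth exact solution `(u, p)` of the fractional Navier–Stokes equations
(5.9) on `S_j = [jτ_q - τ_q, jτ_q + τ_q] ∩ [0,T]` with `u = v_ℓ` at the left endpoint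
`max(jτ_q - τ_q, 0)` of `S_j` ("`0 ≤ t - tᵢ ≤ 2τ_q`"): Cor. 5.2 `‖u‖_{N+α} ≤ C τ_q⁻¹ ℓ^{1-N+α}`
(`1 ≤ N ≤ N̄`), (5.10) `‖u - v_ℓ‖_{N+α} ≤ C τ_q δ_{q+1} ℓ^{-N-1+α}`, (5.11)
`‖∇(p_ℓ - p)‖_{N+α} ≤ C δ_{q+1} ℓ^{-N-1+α}` and (5.12) `‖D_{t,ℓ}(u - v_ℓ)‖_{N+α} ≤ C δ_{q+1} ℓ^{-N-1+α}`
(`N ≤ N̄`) on `S_j`, i.e. `BDSV.StabilityBounds β α a b T C q N̄ j v_ℓ p_ℓ u p`.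
[cite: Derosa2018, §5.2 Cor. 5.2 and Prop. 5.3 ((5.8)–(5.12), (5.34))] -/
theorem stabilityBounds_of_exact :
    ∀ β : ℝ, 0 < β → β < 1 / 3 → ∀ γ : ℝ, 0 < γ → γ < β →
      ∀ b : ℝ, 1 < b → b < (1 - β) / (2 * β) →
        ∃ α₀ : ℝ, 0 < α₀ ∧ ∀ α : ℝ, 0 < α → α < α₀ → ∀ (Nbar : ℕ) (Cin : ℕ → ℝ),
          ∃ (C a₀ : ℝ), 1 < a₀ ∧ ∀ a : ℝ, a₀ ≤ a → ∀ ν : ℝ, 0 ≤ ν → ν ≤ 1 → ∀ T : ℝ, 0 < T →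
            ∀ (q : ℕ) (vℓ : ℝ → UnitAddTorus (Fin 3) → EuclideanSpace ℝ (Fin 3))
              (pℓ : ℝ → UnitAddTorus (Fin 3) → ℝ) (Rℓ : ℝ → UnitAddTorus (Fin 3) → Fin 3 → EuclideanSpace ℝ (Fin 3)),
              Torus.IsFracNSReynoldsOn (Icc 0 T) γ ν vℓ pℓ Rℓ →
              (∀ N : ℕ, HolderSupLE T vℓ (N + 1) 0
                (Cin N * (Real.sqrt (amp β a b q) * freq a b q * mollScale β α a b q ^ (-(N : ℝ))))) →
              (∀ N : ℕ, HolderSupLE T Rℓ N (Real.toNNReal α)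
                (Cin N * (amp β a b (q + 1) * mollScale β α a b q ^ (-(N : ℝ) + α)))) →
              ∀ (i : ℕ) (v : ℝ → UnitAddTorus (Fin 3) → EuclideanSpace ℝ (Fin 3)) (p : ℝ → UnitAddTorus (Fin 3) → ℝ),
                (i : ℝ) * glueScale β α a b q ≤ T →
                Torus.IsFracNSReynoldsOn (glueInterval T (glueScale β α a b q) i) γ ν v p (fun _ _ _ => 0) →
                v (max ((i : ℝ) * glueScale β α a b q - glueScale β α a b q) 0) =
                  vℓ (max ((i : ℝ) * glueScale β α a b q - glueScale β α a b q) 0) →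
                  StabilityBounds β α a b T C q Nbar i vℓ pℓ v p := by
  intro β hβ hβ3 γ hγ hγβ b hb hb'
  have hβ1 : β < 1 := by linarith
  have hγ3 : γ < 1 / 3 := by linarith
  have hb1 : 1 ≤ b := hb.le
  have hβ0 : 0 ≤ β := hβ.le
  -- the threshold on `α`: `2γ + 2α ≤ 1`, `α < 1`, and `3αγ ≤ (1-β)(1-3γ)` for (5.34)
  set α₀ : ℝ := min (1 / 2) (min ((1 - 2 * γ) / 2) ((1 - β) * (1 - 3 * γ) / (3 * γ))) with hα₀
  have hα₀pos : 0 < α₀ := by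
    refine lt_min (by norm_num) (lt_min (by linarith) ?_)
    exact div_pos (mul_pos (by linarith) (by linarith)) (by linarith)
  refine ⟨α₀, hα₀pos, fun α hα hαlt Nbar Cin => ?_⟩
  have hα12 : α < 1 / 2 := lt_of_lt_of_le hαlt (min_le_left _ _)
  have hα1 : α < 1 := by linarith
  have hαs : 2 * γ + 2 * α ≤ 1 := by
    have := lt_of_lt_of_le hαlt ((min_le_right _ _).trans (min_le_left _ _)); linarith
  have hαγ : 3 * α * γ ≤ (1 - β) * (1 - 3 * γ) := by
    have h := lt_of_lt_of_le hαlt ((min_le_right _ _).trans (min_le_right _ _))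
    have h3γ : 0 < 3 * γ := by linarith
    have := (lt_div_iff₀ h3γ).1 h
    linarith
  set α' : ℝ≥0 := Real.toNNReal α with hα'def
  have hα' : 0 < α' := Real.toNNReal_pos.2 hα
  have hα1' : α' < 1 := Real.toNNReal_lt_one.2 hα1
  have hαc : ((α' : ℝ≥0) : ℝ) = α := Real.coe_toNNReal α hα.le
  -- the Hölder exponent of (5.34): `s = 2γ + 2α`
  set s : ℝ≥0 := ⟨2 * γ + 2 * α, by linarith⟩ with hsdef
  have hs_coe : ((s : ℝ≥0) : ℝ) = 2 * γ + 2 * α := rfl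
  have hs : 2 * γ + (α' : ℝ) < (s : ℝ) := by rw [hαc, hs_coe]; linarith
  have hs1 : s ≤ 1 := by rw [← NNReal.coe_le_coe, hs_coe]; exact_mod_cast hαs
  -- the dimensionless constants
  obtain ⟨cA, hcA, CA, hCA1, hAp⟩ := fracNSApriori hα' hα1' (Nbar + 2)
  obtain ⟨cS, hcS, CS, hCS0, hSt⟩ := fracStability hα' hα1' (Nbar + 1)
  have h71 : ∀ N : ℕ, ∃ C : ℝ≥0, ∀ {u : UnitAddTorus (Fin 3) → EuclideanSpace ℝ (Fin 3)}, IsSmooth u →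
      Torus.eContDiffHolderNorm N α' (Torus.fracLaplacian γ u) ≤ C * Torus.eContDiffHolderNorm N s u :=
    fun N => Torus.exists_eContDiffHolderNorm_fracLaplacian_le (Fin 3) hγ (by linarith) hs hs1 N
  choose C71 hC71 using h71
  -- the input constants, made uniform
  set Kmax : ℝ := ∑ m ∈ Finset.range (Nbar + 2), (((m : ℝ) + 4) * |Cin m| + |Cin (m + 1)|) with hKmax
  have hKmax0 : 0 ≤ Kmax := Finset.sum_nonneg fun _ _ => by positivity
  have hKm : ∀ m : ℕ, m ≤ Nbar + 1 → ((m : ℝ) + 4) * |Cin m| + |Cin (m + 1)| ≤ Kmax := fun m hm =>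
    Finset.single_le_sum (f := fun m : ℕ => ((m : ℝ) + 4) * |Cin m| + |Cin (m + 1)|) (fun _ _ => by positivity)
      (Finset.mem_range.2 (by omega))
  set Emax : ℝ := ∑ m ∈ Finset.range (Nbar + 3), |Cin m| with hEmax
  have hEmax0 : 0 ≤ Emax := Finset.sum_nonneg fun _ _ => abs_nonneg _
  have hEm : ∀ m : ℕ, m ≤ Nbar + 2 → |Cin m| ≤ Emax := fun m hm =>
    Finset.single_le_sum (f := fun m : ℕ => |Cin m|) (fun _ _ => abs_nonneg _) (Finset.mem_range.2 (by omega))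
  set S71 : ℝ := ∑ N ∈ Finset.range (Nbar + 1), ((N : ℝ) + 4) * (C71 N : ℝ) with hS71
  have hS710 : 0 ≤ S71 := Finset.sum_nonneg fun _ _ => by positivity
  have hS71N : ∀ N : ℕ, N ≤ Nbar → ((N : ℝ) + 4) * (C71 N : ℝ) ≤ S71 := fun N hN =>
    Finset.single_le_sum (f := fun N : ℕ => ((N : ℝ) + 4) * (C71 N : ℝ)) (fun _ _ => by positivity)
      (Finset.mem_range.2 (by omega))
  -- the output constant
  set C : ℝ := CA * (1 + Kmax) + 2 * CS * Emax * (1 + 2 * S71) with hCdef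
  -- the thresholds: CFL for Prop. 3.5 and Prop. 5.3, and (5.34)
  have hE34 : (β - 1 - 3 * α / 2) * (2 * α - (2 * γ + 2 * α)) + (β - 1) + b * (-β * (2 * α - (2 * γ + 2 * α))) < 0 := by
    have h1 : b * β < (1 - β) / 2 := by
      have h2β : 0 < 2 * β := by linarith
      have := (lt_div_iff₀ h2β).1 hb'
      linarith
    nlinarith
  obtain ⟨a₁, ha₁, hCFL⟩ := exists_threshold_cfl (β := β) hb1 hβ0 hα (lt_min hcA hcS) (2 * (CA * (1 + Kmax)))
  obtain ⟨a₂, ha₂, hP34⟩ := exists_threshold_glueScale_rpow (β := β) (α := α) hb1 hE34 1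
  refine ⟨C, max 2 (max a₁ a₂), lt_of_lt_of_le one_lt_two (le_max_left _ _),
    fun a ha ν hν0 hν1 T hT q vℓ pℓ Rℓ hNSR h213 h214 i v p hiT hex hanch => ?_⟩
  have ha2 : 2 ≤ a := le_trans (le_max_left _ _) ha
  have ha1 : 1 ≤ a := by linarith
  have haa₁ : a₁ ≤ a := le_trans ((le_max_left _ _).trans (le_max_right _ _)) ha
  have haa₂ : a₂ ≤ a := le_trans ((le_max_right _ _).trans (le_max_right _ _)) ha
  -- the scales
  set τ := glueScale β α a b q with hτdef
  set ℓ := mollScale β α a b q with hℓdef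
  set δ := amp β a b (q + 1) with hδdef
  set A := Real.sqrt (amp β a b q) * freq a b q with hAdef
  have hτ : 0 < τ := glueScale_pos ha1 q
  have hℓ : 0 < ℓ := mollScale_pos ha1 q
  have hℓ1 : ℓ ≤ 1 := mollScale_le_one ha1 hb1 hβ0 hα.le q
  have hδ : 0 < δ := amp_pos ha1 (q + 1)
  have hA : 0 < A := mul_pos (Real.sqrt_pos.2 (amp_pos ha1 q)) (freq_pos ha1 q)
  -- `Λ = ℓ⁻¹ ≥ 1`
  have hΛ1 : 1 ≤ ℓ⁻¹ := one_le_inv_iff₀.2 ⟨hℓ, hℓ1⟩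
  have hΛ0 : 0 < ℓ⁻¹ := by positivity
  -- the life span
  set a' := max ((i : ℝ) * τ - τ) 0 with ha'
  set b' := min ((i : ℝ) * τ + τ) T with hb'def
  have hS : glueInterval T τ i = Icc a' b' := glueInterval_eq_Icc T τ i
  have hi0 : 0 ≤ (i : ℝ) * τ := by positivity
  have hab : a' < b' := by
    simp only [ha', hb'def, max_lt_iff, lt_min_iff]
    refine ⟨⟨by linarith, by linarith⟩, by linarith, hT⟩
  have hsub : Icc a' b' ⊆ Icc 0 T := by rw [← hS]; exact glueInterval_subset_Icc T τ i
  have hlen : b' - a' ≤ 2 * τ := by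
    have h1 : b' ≤ (i : ℝ) * τ + τ := min_le_left _ _
    have h2 : (i : ℝ) * τ - τ ≤ a' := le_max_left _ _
    linarith
  have hlen0 : 0 ≤ b' - a' := by linarith
  have hexI : Torus.IsFracNSReynoldsOn (Icc a' b') γ ν v p (fun _ _ _ => 0) := by rwa [hS] at hex
  have hℓI : Torus.IsFracNSReynoldsOn (Icc a' b') γ ν vℓ pℓ Rℓ := hNSR.mono hsub (uniqueDiffOn_Icc hab)
  have hanch' : v a' = vℓ a' := hanch
  -- the dimensionless data: `U = (1 + K) A ℓ^{-α}`, `Λ = ℓ⁻¹`, `E = E_max δ ℓ^α`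
  set U : ℝ := (1 + Kmax) * (A * ℓ ^ (-α)) with hUdef
  have hU : 0 < U := by positivity
  set E : ℝ := Emax * (δ * ℓ ^ α) with hEdef
  have hE0 : 0 ≤ E := by positivity
  -- (5.6) interpolated: `‖v_ℓ(t)‖_{m,α} ≤ U Λ^{m-1}` for `1 ≤ m ≤ N̄ + 2` on `[0,T]`
  have hvℓ : ∀ t ∈ Icc 0 T, ∀ m : ℕ, 1 ≤ m → m ≤ Nbar + 2 →
      Torus.eContDiffHolderNorm m α' (vℓ t) ≤ ENNReal.ofReal (U * ℓ⁻¹ ^ (m - 1)) := by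
    intro t ht m hm1 hm2
    obtain ⟨N, rfl⟩ : ∃ N, m = N + 1 := ⟨m - 1, by omega⟩
    have key := eContDiffHolderNorm_succ_le_of_holderSupLE (Cin := Cin) hα hα1 hℓ hℓ1 hA.le
      (fun s hs => hNSR.smooth_velocity.isSmooth_slice hs) h213 ht N
    refine key.trans (ENNReal.ofReal_le_ofReal ?_)
    rw [Nat.add_sub_cancel]
    have e : ℓ ^ (-(N : ℝ) - α) = ℓ ^ (-α) * ℓ⁻¹ ^ N := rpow_neg_natCast_sub hℓ α N
    rw [e]
    calc (((N : ℝ) + 4) * |Cin N| + |Cin (N + 1)|) * (A * (ℓ ^ (-α) * ℓ⁻¹ ^ N))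
        ≤ Kmax * (A * (ℓ ^ (-α) * ℓ⁻¹ ^ N)) := mul_le_mul_of_nonneg_right (hKm N (by omega)) (by positivity)
      _ ≤ (1 + Kmax) * (A * (ℓ ^ (-α) * ℓ⁻¹ ^ N)) :=
          mul_le_mul_of_nonneg_right (le_add_of_nonneg_left zero_le_one) (by positivity)
      _ = U * ℓ⁻¹ ^ N := by rw [hUdef]; ring
  -- (5.7′): `‖R̊_ℓ(t)‖_{m,α} ≤ E Λ^m` for `m ≤ N̄ + 2`
  have hRℓ : ∀ t ∈ Icc 0 T, ∀ m : ℕ, m ≤ Nbar + 2 →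
      Torus.eContDiffHolderNorm m α' (Rℓ t) ≤ ENNReal.ofReal (E * ℓ⁻¹ ^ m) := by
    intro t ht m hm
    refine (h214 m t ht).trans (ENNReal.ofReal_le_ofReal ?_)
    have e : ℓ ^ (-(m : ℝ) + α) = ℓ ^ α * ℓ⁻¹ ^ m := rpow_neg_natCast_add hℓ α m
    rw [e]
    calc Cin m * (δ * (ℓ ^ α * ℓ⁻¹ ^ m)) ≤ |Cin m| * (δ * (ℓ ^ α * ℓ⁻¹ ^ m)) :=
          mul_le_mul_of_nonneg_right (le_abs_self _) (by positivity)
      _ ≤ Emax * (δ * (ℓ ^ α * ℓ⁻¹ ^ m)) := mul_le_mul_of_nonneg_right (hEm m hm) (by positivity)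
      _ = E * ℓ⁻¹ ^ m := by rw [hEdef]; ring
  -- the CFL conditions `(b' - a') U ≤ c_A`, `(b' - a') (C_A U) ≤ c_S`
  have hcfl : 2 * τ * (CA * U) ≤ min cA cS := by
    have e : 2 * τ * (CA * U) = 2 * (CA * (1 + Kmax)) * ℓ ^ α := by
      have h1 := glueScale_mul_cflBound (β := β) (α := α) (b := b) ha1 q (1 + Kmax)
      calc 2 * τ * (CA * U) = 2 * CA * (τ * ((1 + Kmax) * (A * ℓ ^ (-α)))) := by rw [hUdef]; ring
        _ = 2 * CA * ((1 + Kmax) * ℓ ^ α) := by rw [hτdef, hAdef, hℓdef, h1]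
        _ = 2 * (CA * (1 + Kmax)) * ℓ ^ α := by ring
    rw [e]
    exact hCFL a haa₁ q
  have hcflA : (b' - a') * U ≤ cA := by
    have h1 : (b' - a') * U ≤ 2 * τ * U := mul_le_mul_of_nonneg_right hlen hU.le
    have h2 : 2 * τ * U ≤ 2 * τ * (CA * U) := by
      have : U ≤ CA * U := le_mul_of_one_le_left hU.le hCA1
      exact mul_le_mul_of_nonneg_left this (by positivity)
    exact h1.trans (h2.trans ((hcfl.trans (min_le_left _ _))))
  have hcflS : (b' - a') * (CA * U) ≤ cS :=
    ((mul_le_mul_of_nonneg_right hlen (by positivity)).trans hcfl).trans (min_le_right _ _)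
  -- Prop. 3.5: `‖u(t)‖_{m,α} ≤ C_A U Λ^{m-1}` for `1 ≤ m ≤ N̄ + 2` on the life span
  have hdat : ∀ m : ℕ, 1 ≤ m → m ≤ Nbar + 2 → Torus.eContDiffHolderNorm m α' (v a') ≤ ENNReal.ofReal (U * ℓ⁻¹ ^ (m - 1)) := by
    intro m hm1 hm2
    rw [hanch']
    exact hvℓ a' (hsub ⟨le_rfl, hab.le⟩) m hm1 hm2
  have hv : ∀ t ∈ Icc a' b', ∀ m : ℕ, 1 ≤ m → m ≤ Nbar + 2 →
      Torus.eContDiffHolderNorm m α' (v t) ≤ ENNReal.ofReal (CA * U * ℓ⁻¹ ^ (m - 1)) :=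
    hAp hab hν0 hγ (by linarith) hexI hU hΛ1 hdat hcflA
  -- Prop. 5.3 with `U' = C_A U`
  have hCAU : 0 < CA * U := by positivity
  have hvℓ' : ∀ t ∈ Icc a' b', ∀ m : ℕ, 1 ≤ m → m ≤ Nbar + 1 + 1 →
      Torus.eContDiffHolderNorm m α' (vℓ t) ≤ ENNReal.ofReal (CA * U * ℓ⁻¹ ^ (m - 1)) := by
    intro t ht m hm1 hm2
    have h0 : 0 ≤ U * ℓ⁻¹ ^ (m - 1) := by positivity
    have key : U * ℓ⁻¹ ^ (m - 1) ≤ CA * U * ℓ⁻¹ ^ (m - 1) :=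
      calc U * ℓ⁻¹ ^ (m - 1) = 1 * (U * ℓ⁻¹ ^ (m - 1)) := (one_mul _).symm
        _ ≤ CA * (U * ℓ⁻¹ ^ (m - 1)) := mul_le_mul_of_nonneg_right hCA1 h0
        _ = CA * U * ℓ⁻¹ ^ (m - 1) := (mul_assoc _ _ _).symm
    exact (hvℓ t (hsub ht) m hm1 (by omega)).trans (ENNReal.ofReal_le_ofReal key)
  have hv' : ∀ t ∈ Icc a' b', ∀ m : ℕ, 1 ≤ m → m ≤ Nbar + 1 + 1 →
      Torus.eContDiffHolderNorm m α' (v t) ≤ ENNReal.ofReal (CA * U * ℓ⁻¹ ^ (m - 1)) :=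
    fun t ht m hm1 hm2 => hv t ht m hm1 (by omega)
  have hR' : ∀ t ∈ Icc a' b', ∀ m : ℕ, m ≤ Nbar + 1 + 1 →
      Torus.eContDiffHolderNorm m α' (Rℓ t) ≤ ENNReal.ofReal (E * ℓ⁻¹ ^ m) :=
    fun t ht m hm => hRℓ t (hsub ht) m (by omega)
  have hstab := hSt hab hν0 hγ (by linarith) hℓI hexI hanch' hCAU hΛ1 hE0 hvℓ' hv' hR' hcflS
  -- `hstab : ∀ s ∈ [a',b'], ∀ N ≤ N̄+1, (5.10) ∧ (5.11) ∧ (5.12′)` with constants `C_S (b'-a') E Λ^{N+1}`, `C_S E Λ^{N+1}`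
  -- conversions of the right-hand sides
  have hconv10 : ∀ N : ℕ, CS * (b' - a') * E * ℓ⁻¹ ^ (N + 1) ≤ 2 * CS * Emax * (τ * δ * ℓ ^ (-(N : ℝ) - 1 + α)) := by
    intro N
    have e : τ * δ * ℓ ^ (-(N : ℝ) - 1 + α) = τ * (δ * ℓ ^ α) * ℓ⁻¹ ^ (N + 1) := by
      rw [rpow_neg_natCast_sub_one_add hℓ α N]; ring
    rw [e]
    calc CS * (b' - a') * E * ℓ⁻¹ ^ (N + 1) ≤ CS * (2 * τ) * E * ℓ⁻¹ ^ (N + 1) :=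
          mul_le_mul_of_nonneg_right (mul_le_mul_of_nonneg_right (mul_le_mul_of_nonneg_left hlen hCS0) hE0)
            (by positivity)
      _ = 2 * CS * Emax * (τ * (δ * ℓ ^ α) * ℓ⁻¹ ^ (N + 1)) := by rw [hEdef]; ring
  have hconv11 : ∀ N : ℕ, CS * E * ℓ⁻¹ ^ (N + 1) = CS * Emax * (δ * ℓ ^ (-(N : ℝ) - 1 + α)) := by
    intro N
    rw [rpow_neg_natCast_sub_one_add hℓ α N, hEdef]; ring
  have hCSE : 0 ≤ CS * Emax := mul_nonneg hCS0 hEmax0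
  have hCAK : 0 ≤ CA * (1 + Kmax) := by positivity
  have hCge10 : 2 * CS * Emax ≤ C := by
    have key : C - 2 * CS * Emax = CA * (1 + Kmax) + 4 * S71 * (CS * Emax) := by rw [hCdef]; ring
    have h4 : 0 ≤ 4 * S71 * (CS * Emax) := by positivity
    linarith only [key, hCAK, h4]
  have hCge11 : CS * Emax ≤ C := by linarith only [hCge10, hCSE]
  refine ⟨?_, ?_, ?_, ?_⟩
  · -- Cor. 5.2: `‖u‖_{N+α} ≤ C τ⁻¹ ℓ^{1-N+α}`, `1 ≤ N ≤ N̄`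
    intro N hN1 hN t ht
    rw [hS] at ht
    refine (hv t ht N hN1 (by omega)).trans (ENNReal.ofReal_le_ofReal ?_)
    -- `C_A U Λ^{N-1} = C_A (1+K) · τ⁻¹ ℓ^{1-N+α}`
    have e : τ⁻¹ * ℓ ^ (1 - (N : ℝ) + α) = A * ℓ ^ (-α) * ℓ⁻¹ ^ (N - 1) := by
      obtain ⟨M, rfl⟩ : ∃ M, N = M + 1 := ⟨N - 1, by omega⟩
      rw [hτdef, glueScale_inv_eq ha1 q, ← hAdef, ← hℓdef, Nat.add_sub_cancel]
      calc A * ℓ ^ (-(2 * α)) * ℓ ^ (1 - ((M + 1 : ℕ) : ℝ) + α)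
          = A * (ℓ ^ (-(2 * α)) * ℓ ^ (1 - ((M + 1 : ℕ) : ℝ) + α)) := mul_assoc _ _ _
        _ = A * (ℓ ^ (-α) * ℓ⁻¹ ^ M) := by rw [rpow_velocity_conversion hℓ α M]
        _ = A * ℓ ^ (-α) * ℓ⁻¹ ^ M := (mul_assoc _ _ _).symm
    rw [e]
    calc CA * U * ℓ⁻¹ ^ (N - 1) = CA * (1 + Kmax) * (A * ℓ ^ (-α) * ℓ⁻¹ ^ (N - 1)) := by rw [hUdef]; ring
      _ ≤ C * (A * ℓ ^ (-α) * ℓ⁻¹ ^ (N - 1)) := by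
          refine mul_le_mul_of_nonneg_right ?_ (by positivity)
          have key : C - CA * (1 + Kmax) = 2 * (CS * Emax) * (1 + 2 * S71) := by rw [hCdef]; ring
          have h4 : 0 ≤ 2 * (CS * Emax) * (1 + 2 * S71) := by positivity
          linarith only [key, h4]
  · -- (5.10)
    intro N hN t ht
    rw [hS] at ht
    refine ((hstab t ht N (by omega)).1).trans (ENNReal.ofReal_le_ofReal ?_)
    refine (hconv10 N).trans ?_
    exact mul_le_mul_of_nonneg_right hCge10 (by positivity)
  · -- (5.11): `‖∇(p_ℓ - p)‖_{N+α} = ‖∇(p - p_ℓ)‖_{N+α}`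
    intro N hN t ht
    rw [hS] at ht
    have hps : IsSmooth (p t) := hexI.smooth_pressure.isSmooth_slice ht
    have hpℓs : IsSmooth (pℓ t) := hℓI.smooth_pressure.isSmooth_slice ht
    have hd : IsSmooth (fun y => p t y - pℓ t y) := hps.sub hpℓs
    have e : (fun x => FunctionSpaces.Torus.gradient (fun y => pℓ t y - p t y) x) =
        (-1 : ℝ) • fun x => FunctionSpaces.Torus.gradient (fun y => p t y - pℓ t y) x := by
      funext x
      have e1 : (fun y => pℓ t y - p t y) = fun y => (-1 : ℝ) * (p t y - pℓ t y) := by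
        funext y; ring
      rw [e1, Torus.gradient_const_mul_apply (hd.isContDiff (by simp))]
      simp
    show Torus.eContDiffHolderNorm N α' (fun x => FunctionSpaces.Torus.gradient (fun y => pℓ t y - p t y) x) ≤ _
    rw [e, Torus.eContDiffHolderNorm_const_smul (hd.gradient.isContDiff (mod_cast le_top))]
    simp only [enorm_neg, enorm_one, one_mul]
    refine ((hstab t ht N (by omega)).2.1).trans (ENNReal.ofReal_le_ofReal ?_)
    rw [hconv11 N]
    exact mul_le_mul_of_nonneg_right hCge11 (by positivity)
  · -- (5.12) from (5.12′) and (5.34)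
    intro N hN t ht
    rw [hS] at ht ⊢
    have htT : t ∈ Icc 0 T := hsub ht
    set w : ℝ → UnitAddTorus (Fin 3) → EuclideanSpace ℝ (Fin 3) := fun r y => v r y - vℓ r y with hwdef
    have hws : IsSmooth (w t) := (hexI.smooth_velocity.isSmooth_slice ht).sub (hℓI.smooth_velocity.isSmooth_slice ht)
    have hvℓt : IsSmooth (vℓ t) := hℓI.smooth_velocity.isSmooth_slice ht
    -- the two levels of (5.10) as sup bounds on the derivatives
    obtain ⟨h10N, -, hL⟩ := hstab t ht N (by omega)
    obtain ⟨h10N1, -, -⟩ := hstab t ht (N + 1) (by omega)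
    set X : ℕ → ℝ := fun k => CS * (b' - a') * E * ℓ⁻¹ ^ (k + 1) with hXdef
    have hX0 : ∀ k, 0 ≤ X k := fun k => by positivity
    -- interpolation: `‖w‖_{N,s} ≤ (N+1) X_N + X_{N+1} ℓ^{1-s} + 2 X_N ℓ^{-s}`
    set M : ℕ → ℝ := fun k => if k ≤ N then X N else X (N + 1) with hMdef
    have hM0 : ∀ k, 0 ≤ M k := fun k => by simp only [hMdef]; split_ifs <;> exact hX0 _
    have hg : ContDiff ℝ (N + 1) (FunctionSpaces.Torus.lift (w t)) := hws.isContDiff (mod_cast le_top)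
    have hMb : ∀ k ≤ N + 1, ∀ y : EuclideanSpace ℝ (Fin 3), ‖iteratedFDeriv ℝ k (FunctionSpaces.Torus.lift (w t)) y‖ ≤ M k := by
      intro k hk y
      rcases Nat.lt_or_ge k (N + 1) with hk1 | hk1
      · have hk' : k ≤ N := by omega
        simp only [hMdef, if_pos hk']
        have := norm_iteratedFDeriv_lift_le_of_eContDiffHolderNorm_le h10N hk' y
        rwa [max_eq_left (hX0 N)] at this
      · have hk' : k = N + 1 := by omega
        subst hk'
        simp only [hMdef, show ¬ (N + 1 ≤ N) from by omega, if_false]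
        have := norm_iteratedFDeriv_lift_le_of_eContDiffHolderNorm_le h10N1 le_rfl y
        rwa [max_eq_left (hX0 (N + 1))] at this
    have hinterp := FunctionSpaces.eContDiffHolderNorm_le_of_norm_iteratedFDeriv_le (k := N) hg hM0 hMb hs1 hℓ
    have hsum : (∑ k ∈ Finset.range (N + 1), M k) = ((N : ℝ) + 1) * X N := by
      rw [Finset.sum_congr rfl fun k hk => by
        rw [show M k = X N from if_pos (Nat.lt_succ_iff.1 (Finset.mem_range.1 hk))]]
      rw [Finset.sum_const, Finset.card_range, nsmul_eq_mul]
      push_cast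
      ring
    have hMN : M N = X N := by simp [hMdef]
    have hMN1 : M (N + 1) = X (N + 1) := by simp [hMdef]
    have hℓs : ℓ⁻¹ ^ (s : ℝ) = ℓ ^ (-(s : ℝ)) := by rw [Real.inv_rpow hℓ.le, Real.rpow_neg hℓ.le]
    have hws_bound : Torus.eContDiffHolderNorm N s (w t) ≤
        ENNReal.ofReal (((N : ℝ) + 4) * (CS * (b' - a') * E * ℓ⁻¹ ^ (N + 1)) * ℓ ^ (-(s : ℝ))) := by
      refine hinterp.trans (ENNReal.ofReal_le_ofReal ?_)
      rw [hsum, hMN, hMN1, hℓs]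
      -- `Λ^{N+2} ℓ^{1-s} = Λ^{N+1} ℓ^{-s}` and `Λ^{N+1} ≤ Λ^{N+1} ℓ^{-s}`
      have hℓms : 1 ≤ ℓ ^ (-(s : ℝ)) := Real.one_le_rpow_of_pos_of_le_one_of_nonpos hℓ hℓ1 (by
        have := s.coe_nonneg; linarith)
      have e1 : X (N + 1) * ℓ ^ (1 - (s : ℝ)) = X N * ℓ ^ (-(s : ℝ)) := by
        simp only [hXdef]
        rw [mul_assoc, inv_pow_succ_mul_rpow hℓ (s : ℝ) N, ← mul_assoc]
      have e2 : ((N : ℝ) + 1) * X N ≤ ((N : ℝ) + 1) * X N * ℓ ^ (-(s : ℝ)) :=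
        le_mul_of_one_le_right (by positivity) hℓms
      rw [e1]
      have key : ((N : ℝ) + 4) * (CS * (b' - a') * E * ℓ⁻¹ ^ (N + 1)) * ℓ ^ (-(s : ℝ)) -
          (((N : ℝ) + 1) * X N + (X N * ℓ ^ (-(s : ℝ)) + 2 * X N * ℓ ^ (-(s : ℝ)))) =
          ((N : ℝ) + 1) * X N * ℓ ^ (-(s : ℝ)) - ((N : ℝ) + 1) * X N := by
        simp only [hXdef]; ring
      linarith only [key, e2]
    -- Thm. 7.1: `ν‖(-Δ)^γ w‖_{N,α} ≤ C71 ‖w‖_{N,s}`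
    have h71w := hC71 N hws
    -- (5.34): `(b' - a') ℓ^{-s} ≤ 2 τ ℓ^{-s} ≤ 2`
    have hP : (b' - a') * ℓ ^ (-(s : ℝ)) ≤ 2 := by
      have h1 := hP34 a haa₂ q
      rw [one_mul] at h1
      have h2 : (b' - a') * ℓ ^ (-(s : ℝ)) ≤ 2 * τ * ℓ ^ (-(s : ℝ)) := mul_le_mul_of_nonneg_right hlen (Real.rpow_nonneg hℓ.le _)
      rw [← hτdef, ← hℓdef] at h1
      rw [hs_coe] at h2 ⊢
      have h3 : 2 * τ * ℓ ^ (-(2 * γ + 2 * α)) = 2 * (τ * ℓ ^ (-(2 * γ + 2 * α))) := by ring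
      linarith only [h1, h2, h3]
    -- the transport derivative as `L - ν(-Δ)^γ w`
    have hLs : IsSmooth (fun x => FunctionSpaces.Torus.timeDerivWithin (Icc a' b') w t x +
        FunctionSpaces.Torus.convect (vℓ t) (w t) x + ν • Torus.fracLaplacian γ (w t) x) := by
      have hwst : FunctionSpaces.Torus.IsSmoothSpaceTimeOn (Icc a' b') w :=
        hexI.smooth_velocity.sub hℓI.smooth_velocity
      have h1 : IsSmooth (FunctionSpaces.Torus.timeDerivWithin (Icc a' b') w t) :=
        (hwst.timeDerivWithin (uniqueDiffOn_Icc hab)).isSmooth_slice ht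
      have h2 : IsSmooth (FunctionSpaces.Torus.convect (vℓ t) (w t)) := hvℓt.convect hws
      have h3 : IsSmooth (fun x => ν • Torus.fracLaplacian γ (w t) x) := (hws.fracLaplacian hγ.le).smul ν
      exact (h1.add h2).add h3
    have hΛs : IsSmooth (fun x => ν • Torus.fracLaplacian γ (w t) x) := (hws.fracLaplacian hγ.le).smul ν
    have eAdv : advectiveDerivWithin (Icc a' b') vℓ w t =
        (fun x => FunctionSpaces.Torus.timeDerivWithin (Icc a' b') w t x +
          FunctionSpaces.Torus.convect (vℓ t) (w t) x + ν • Torus.fracLaplacian γ (w t) x) -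
          fun x => ν • Torus.fracLaplacian γ (w t) x := by
      funext x
      simp [advectiveDerivWithin]
    rw [eAdv]
    calc Torus.eContDiffHolderNorm N α'
          ((fun x => FunctionSpaces.Torus.timeDerivWithin (Icc a' b') w t x +
            FunctionSpaces.Torus.convect (vℓ t) (w t) x + ν • Torus.fracLaplacian γ (w t) x) -
            fun x => ν • Torus.fracLaplacian γ (w t) x)
        ≤ Torus.eContDiffHolderNorm N α' (fun x => FunctionSpaces.Torus.timeDerivWithin (Icc a' b') w t x +
            FunctionSpaces.Torus.convect (vℓ t) (w t) x + ν • Torus.fracLaplacian γ (w t) x) +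
            Torus.eContDiffHolderNorm N α' (fun x => ν • Torus.fracLaplacian γ (w t) x) :=
          Torus.eContDiffHolderNorm_sub_le (hLs.isContDiff (mod_cast le_top)) (hΛs.isContDiff (mod_cast le_top))
      _ ≤ ENNReal.ofReal (CS * E * ℓ⁻¹ ^ (N + 1)) +
            ‖ν‖ₑ * (C71 N * ENNReal.ofReal (((N : ℝ) + 4) * (CS * (b' - a') * E * ℓ⁻¹ ^ (N + 1)) * ℓ ^ (-(s : ℝ)))) := by
          refine add_le_add hL ?_
          rw [show (fun x => ν • Torus.fracLaplacian γ (w t) x) = ν • Torus.fracLaplacian γ (w t) from rfl,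
            Torus.eContDiffHolderNorm_const_smul ((hws.fracLaplacian hγ.le).isContDiff (mod_cast le_top))]
          exact mul_le_mul' le_rfl (h71w.trans (mul_le_mul' le_rfl hws_bound))
      _ ≤ ENNReal.ofReal (C * (δ * ℓ ^ (-(N : ℝ) - 1 + α))) := by
          have hν : ‖ν‖ₑ ≤ 1 := by
            rw [Real.enorm_eq_ofReal hν0, ← ENNReal.ofReal_one]; exact ENNReal.ofReal_le_ofReal hν1
          have e71 : (C71 N : ℝ≥0∞) = ENNReal.ofReal (C71 N : ℝ) := (ENNReal.ofReal_coe_nnreal).symm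
          calc ENNReal.ofReal (CS * E * ℓ⁻¹ ^ (N + 1)) +
                ‖ν‖ₑ * (C71 N * ENNReal.ofReal (((N : ℝ) + 4) * (CS * (b' - a') * E * ℓ⁻¹ ^ (N + 1)) * ℓ ^ (-(s : ℝ))))
              ≤ ENNReal.ofReal (CS * E * ℓ⁻¹ ^ (N + 1)) +
                  1 * (C71 N * ENNReal.ofReal (((N : ℝ) + 4) * (CS * (b' - a') * E * ℓ⁻¹ ^ (N + 1)) * ℓ ^ (-(s : ℝ)))) := by
                gcongr
            _ = ENNReal.ofReal (CS * E * ℓ⁻¹ ^ (N + 1) +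
                  (C71 N : ℝ) * (((N : ℝ) + 4) * (CS * (b' - a') * E * ℓ⁻¹ ^ (N + 1)) * ℓ ^ (-(s : ℝ)))) := by
                rw [one_mul, e71, ← ENNReal.ofReal_mul (C71 N).coe_nonneg, ← ENNReal.ofReal_add (by positivity) (by positivity)]
            _ ≤ ENNReal.ofReal (C * (δ * ℓ ^ (-(N : ℝ) - 1 + α))) := by
                refine ENNReal.ofReal_le_ofReal ?_
                -- `X ℓ^{-s} (b'-a') ≤ 2 X`, and `C_S E Λ^{N+1} = C_S E_max δℓ^{-N-1+α}`
                have hY : 0 ≤ CS * E * ℓ⁻¹ ^ (N + 1) := by positivity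
                have h2 : (C71 N : ℝ) * (((N : ℝ) + 4) * (CS * (b' - a') * E * ℓ⁻¹ ^ (N + 1)) * ℓ ^ (-(s : ℝ))) ≤
                    2 * (((N : ℝ) + 4) * (C71 N : ℝ)) * (CS * E * ℓ⁻¹ ^ (N + 1)) := by
                  have e : (C71 N : ℝ) * (((N : ℝ) + 4) * (CS * (b' - a') * E * ℓ⁻¹ ^ (N + 1)) * ℓ ^ (-(s : ℝ))) =
                      (((N : ℝ) + 4) * (C71 N : ℝ)) * (CS * E * ℓ⁻¹ ^ (N + 1)) * ((b' - a') * ℓ ^ (-(s : ℝ))) := by ring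
                  rw [e]
                  have : 0 ≤ (((N : ℝ) + 4) * (C71 N : ℝ)) * (CS * E * ℓ⁻¹ ^ (N + 1)) := by positivity
                  calc (((N : ℝ) + 4) * (C71 N : ℝ)) * (CS * E * ℓ⁻¹ ^ (N + 1)) * ((b' - a') * ℓ ^ (-(s : ℝ)))
                      ≤ (((N : ℝ) + 4) * (C71 N : ℝ)) * (CS * E * ℓ⁻¹ ^ (N + 1)) * 2 := mul_le_mul_of_nonneg_left hP this
                    _ = 2 * (((N : ℝ) + 4) * (C71 N : ℝ)) * (CS * E * ℓ⁻¹ ^ (N + 1)) := by ring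
                have h3 : 2 * (((N : ℝ) + 4) * (C71 N : ℝ)) ≤ 2 * S71 := by linarith only [hS71N N hN]
                have h4 : 2 * (((N : ℝ) + 4) * (C71 N : ℝ)) * (CS * E * ℓ⁻¹ ^ (N + 1)) ≤ 2 * S71 * (CS * E * ℓ⁻¹ ^ (N + 1)) :=
                  mul_le_mul_of_nonneg_right h3 hY
                calc CS * E * ℓ⁻¹ ^ (N + 1) + (C71 N : ℝ) * (((N : ℝ) + 4) * (CS * (b' - a') * E * ℓ⁻¹ ^ (N + 1)) * ℓ ^ (-(s : ℝ)))
                    ≤ CS * E * ℓ⁻¹ ^ (N + 1) + 2 * S71 * (CS * E * ℓ⁻¹ ^ (N + 1)) := by linarith only [h2, h4]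
                  _ = (1 + 2 * S71) * (CS * Emax) * (δ * ℓ ^ (-(N : ℝ) - 1 + α)) := by rw [hconv11 N]; ring
                  _ ≤ C * (δ * ℓ ^ (-(N : ℝ) - 1 + α)) := by
                      refine mul_le_mul_of_nonneg_right ?_ (by positivity)
                      have key : C - (1 + 2 * S71) * (CS * Emax) = CA * (1 + Kmax) + (1 + 2 * S71) * (CS * Emax) := by
                        rw [hCdef]; ring
                      have h5 : 0 ≤ (1 + 2 * S71) * (CS * Emax) := by positivity
                      linarith only [key, hCAK, h5]

end Stability

end DeRosa

end Literature.Analysis.FluidPDE
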